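import Summits.Ventures.HodgeKum4.Theorems.KummerFixedLocusHilbertKummerTransferLefschetzModule
import HarnessLib

/-!
# V0 (`HilbertKummerTransfer`) — transport of the dual Lefschetz operator along `Θ^*`:
# `Θ^* ∘ Λ_H = Λ_{A × K} ∘ Θ^*` with `Λ_{A × K} = κ (Λ_A ⊗ 1 + 1 ⊗ Λ_K) κ⁻¹` (cell `hodge-kum4`, lane (V), seat p2; part 2)

Route `KummerFixedLocus`, item `HilbertKummerTransfer` (stmt-Ventures-20354).  HONEST FRAMING: helper theorems;
nothing about V0, L1 or the Hodge conjecture is proved in this file.  Sequel of `…TransferLefschetzModule`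
(`R = im θ^*` is an `𝔰𝔩₂`-module; `Ψ : H*(A) ⊗ R ≃ H*(H)` intertwines `(h, L)`; `L_x ⊗ 1 + 1 ⊗ L_R` is Lefschetz).

* **`hasLefschetzProperty_totalLefschetz_fst`** — the restriction `x` of `ℓ` along an orbit is a Lefschetz class on the
  abelian surface `A` (a tensor FACTOR of a Lefschetz module is Lefschetz, `Algebra.Lie.HasLefschetzProperty.of_tensor`,
  p518660; no ampleness of `x` is needed or claimed).
* **`exists_isDualLefschetz_comp_eq`** (MAIN EXPORT) — there is `Λ_A` with `IsDualLefschetz 2 x Λ_A` such that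
  `Λ_P = κ (Λ_A ⊗ 1 + 1 ⊗ Λ_K) κ⁻¹` is a dual Lefschetz operator of `Θ^* ℓ` on `A × K` (dimension `2 + 2n`,
  `Algebra.Lie.isSl2Triple_rTensor_add_lTensor` transported along the Künneth isomorphism) and
  **`Θ^* ∘ Λ_H = Λ_P ∘ Θ^*`** (naturality of the `𝔰𝔩₂`-partner along the degree-preserving ring homomorphism `Θ^*`,
  `Algebra.Lie.comp_dual_eq_dual_comp_of_isSl2Triple`, p517776).
-/

noncomputable section

open CategoryTheory MonoidalCategory CartesianMonoidalCategory DirectSum TensorProduct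
open Literature.AlgebraicTopology.SingularHomology
open Literature.AlgebraicGeometry Literature.AlgebraicGeometry.Motives Literature.AlgebraicGeometry.Hyperkaehler
open Literature.AlgebraicGeometry.HilbertScheme Literature.AlgebraicGeometry.HodgeTheory
open Literature.Algebra.Lie (degreeSpace IsZGrading HasLefschetzProperty)

namespace Summit.Ventures.HodgeKum4.HilbertKummer

open scoped MonObj

section Main

variable {A : AbelianVariety ℂ} {K H : SchemeOver ℂ} {n k : ℕ} {Ξ : (A.X ⊗ H).left.IdealSheafData}
  {act : A.X ⊗ H ⟶ H} {j : K ⟶ H}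
  {G : Type} [Group G] [Fintype G] [MulAction G (ComplexPoints (A.X ⊗ K))]
  (c : FiniteDeckCover G (ComplexPoints (A.X ⊗ K)) (ComplexPoints H))
  (hc : c.proj = AlgPoints.mapContinuous (L := ℂ) (kummerCover act j))
  (hdeck : ∀ g : G, ∃ (b : 𝟙_ (SchemeOver ℂ) ⟶ A.X) (τ : K ⟶ K),
    c.deck g = AlgPoints.mapContinuous (L := ℂ) (A.translate b⁻¹ ⊗ₘ τ))
  (hS : IsSmoothProjective 2 A.X) (hK : IsSmoothProjective (2 * n) K) (hH : IsHilbertSchemeOfPoints k A.X H Ξ)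
  (hact : IsTranslationAction Ξ act)

/-! ### §4 `x` is Lefschetz on `A`; `Λ_{A × K}`; `Θ^* ∘ Λ_H = Λ_{A × K} ∘ Θ^*` -/

include c hc hdeck hS hK hH hact in
/-- **The restriction `x` of `ℓ` to the abelian surface is a Lefschetz class** (`L_x : H¹ ≅ H³`, `L_x² : H⁰ ≅ H⁴`):
`H*(A)` is a tensor factor of the Lefschetz module `H*(A) ⊗ R ≅ H*(H)` with `R ≠ 0` Lefschetz
(`Algebra.Lie.HasLefschetzProperty.of_tensor`). -/
theorem hasLefschetzProperty_totalLefschetz_fst (hn : 1 ≤ n) (ℓ : complexBetti H 2) {x : complexBetti A.X 2}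
    (hx : complexBetti.map (kummerCover act j) 2 ℓ =
      complexBetti.map (fst A.X K) 2 x + complexBetti.map (snd A.X K) 2 (complexBetti.map j 2 ℓ))
    {Λ_H : Module.End ℂ (totalCohomology ℂ (ComplexPoints H))} (hΛH : IsDualLefschetz (2 * (n + 1)) ℓ Λ_H)
    {Λ_K : Module.End ℂ (totalCohomology ℂ (ComplexPoints K))}
    (hΛK : IsDualLefschetz (2 * n) (complexBetti.map j 2 ℓ) Λ_K) :
    HasLefschetzProperty (degreeOperator ℂ (ComplexPoints A.X) 2) (totalLefschetz x) := by
  haveI := finite_totalCohomology hK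
  haveI : Nontrivial (fibreRange A K (kummerCover act j)) := by
    refine ⟨⟨⟨_, one_mem_fibreRange (A := A) (K := K) (kummerCover act j)⟩, 0, fun h0 ↦ ?_⟩⟩
    have h1 := congrArg Subtype.val h0
    change ofDegree ℂ (ComplexPoints K) 0 (singularCohomology.one ℂ (ComplexPoints K)) = 0 at h1
    exact degreeOperator_one_ne_zero hK hn (by rw [h1, map_zero])
  refine Literature.Algebra.Lie.HasLefschetzProperty.of_tensor (isZGrading_degreeOperator 2)
    (isZGrading_fibreRange c hc hdeck hS hK hH hact) ?_
    (hasLefschetzProperty_fibreRange c hc hdeck hS hK hH hact hn ℓ hΛK)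
    (hasLefschetzProperty_tensor_fibreRange c hc hdeck hS hK hH hact ℓ hx hΛH)
  exact Literature.Algebra.Lie.mapsTo_of_lie_eq_two_nsmul (lie_degreeOperator_totalLefschetz 2 x)

include c hc hdeck hH hact in
/-- **MAIN EXPORT.**  There is a dual Lefschetz operator `Λ_A` of `x` on the abelian surface such that
`Λ_P = κ (Λ_A ⊗ 1 + 1 ⊗ Λ_K) κ⁻¹` is a dual Lefschetz operator of `Θ^* ℓ` on `A × K` (dimension `2 + 2n`) and
**`Θ^* ∘ Λ_H = Λ_P ∘ Θ^*`** (naturality of the `𝔰𝔩₂`-partner along the degree-preserving ring homomorphism `Θ^*`). -/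
theorem exists_isDualLefschetz_comp_eq (hHs : IsSmoothProjective (2 * (n + 1)) H) (hn : 1 ≤ n) (ℓ : complexBetti H 2)
    {x : complexBetti A.X 2}
    (hx : complexBetti.map (kummerCover act j) 2 ℓ =
      complexBetti.map (fst A.X K) 2 x + complexBetti.map (snd A.X K) 2 (complexBetti.map j 2 ℓ))
    {Λ_H : Module.End ℂ (totalCohomology ℂ (ComplexPoints H))} (hΛH : IsDualLefschetz (2 * (n + 1)) ℓ Λ_H)
    {Λ_K : Module.End ℂ (totalCohomology ℂ (ComplexPoints K))}
    (hΛK : IsDualLefschetz (2 * n) (complexBetti.map j 2 ℓ) Λ_K) :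
    ∃ Λ_A : Module.End ℂ (totalCohomology ℂ (ComplexPoints A.X)), IsDualLefschetz 2 x Λ_A ∧
      IsDualLefschetz (2 + 2 * n) (complexBetti.map (kummerCover act j) 2 ℓ)
        ((kunnethEquiv hS hK).conj (Λ_A.rTensor _ + Λ_K.lTensor _)) ∧
      totalPullback ℂ (AlgPoints.mapContinuous (L := ℂ) (kummerCover act j)) ∘ₗ Λ_H =
        ((kunnethEquiv hS hK).conj (Λ_A.rTensor _ + Λ_K.lTensor _)) ∘ₗ
          totalPullback ℂ (AlgPoints.mapContinuous (L := ℂ) (kummerCover act j)) := by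
  haveI := finite_totalCohomology hS
  haveI := finite_totalCohomology hK
  haveI := finite_totalCohomology hHs
  haveI := finite_totalCohomology (IsSmoothProjective.tensor_holds hS hK)
  haveI : Nontrivial (totalCohomology ℂ (ComplexPoints K)) :=
    ⟨⟨ofDegree ℂ (ComplexPoints K) 0 (singularCohomology.one ℂ (ComplexPoints K)), 0,
      fun h0 ↦ degreeOperator_one_ne_zero hK hn (by rw [h0, map_zero])⟩⟩
  -- `Λ_A`
  have LA := hasLefschetzProperty_totalLefschetz_fst c hc hdeck hS hK hH hact hn ℓ hx hΛH hΛK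
  have hA0 : degreeOperator ℂ (ComplexPoints A.X) 2 ≠ 0 := degreeOperator_ne_zero_of_isSmoothProjective hS two_ne_zero
  refine ⟨LA.dual (isZGrading_degreeOperator 2), LA.isSl2Triple_dual (isZGrading_degreeOperator 2) hA0, ?_⟩
  set Λ_A := LA.dual (isZGrading_degreeOperator 2) with hΛA_def
  have hΛA : IsDualLefschetz 2 x Λ_A := LA.isSl2Triple_dual (isZGrading_degreeOperator 2) hA0
  -- the tensor triple on `H*(A) ⊗ H*(K)` and its transport to `H*((A × K)(ℂ))`
  have h0 : (degreeOperator ℂ (ComplexPoints A.X) 2).rTensor (totalCohomology ℂ (ComplexPoints K)) +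
      (degreeOperator ℂ (ComplexPoints K) (2 * n)).lTensor (totalCohomology ℂ (ComplexPoints A.X)) ≠ 0 :=
    Literature.Algebra.Lie.rTensor_add_lTensor_ne_zero hΛA (isZGrading_degreeOperator (2 * n))
  have tT := Literature.Algebra.Lie.isSl2Triple_rTensor_add_lTensor hΛA hΛK h0
  have tP := isSl2Triple_conj (kunnethEquiv hS hK) tT
  have hh : (kunnethEquiv hS hK).conj ((degreeOperator ℂ (ComplexPoints A.X) 2).rTensor _ +
      (degreeOperator ℂ (ComplexPoints K) (2 * n)).lTensor _) =
      degreeOperator ℂ (ComplexPoints (A.X ⊗ K)) (2 + 2 * n) := by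
    refine LinearMap.ext fun v ↦ ?_
    rw [LinearEquiv.conj_apply_apply]
    obtain ⟨t, rfl⟩ := (kunnethEquiv hS hK).surjective v
    rw [LinearEquiv.symm_apply_apply, kunnethEquiv_apply, kunnethEquiv_apply, degreeOperator_totalCross]
  have he : (kunnethEquiv hS hK).conj ((totalLefschetz x).rTensor _ +
      (totalLefschetz (complexBetti.map j 2 ℓ)).lTensor _) =
      totalLefschetz (complexBetti.map (kummerCover act j) 2 ℓ) := by
    refine LinearMap.ext fun v ↦ ?_
    rw [LinearEquiv.conj_apply_apply]
    obtain ⟨t, rfl⟩ := (kunnethEquiv hS hK).surjective v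
    rw [LinearEquiv.symm_apply_apply, kunnethEquiv_apply, kunnethEquiv_apply, hx, totalLefschetz_totalCross]
  rw [hh, he] at tP
  refine ⟨tP, ?_⟩
  -- naturality of the partner along `Θ^*`
  have hφh : totalPullback ℂ (AlgPoints.mapContinuous (L := ℂ) (kummerCover act j)) ∘ₗ
      degreeOperator ℂ (ComplexPoints H) (2 * (n + 1)) =
      degreeOperator ℂ (ComplexPoints (A.X ⊗ K)) (2 + 2 * n) ∘ₗ
        totalPullback ℂ (AlgPoints.mapContinuous (L := ℂ) (kummerCover act j)) := by
    refine LinearMap.ext fun w ↦ ?_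
    simp only [LinearMap.coe_comp, Function.comp_apply]
    rw [degreeOperator_totalPullback, show 2 + 2 * n = 2 * (n + 1) by ring]
  have hφe : totalPullback ℂ (AlgPoints.mapContinuous (L := ℂ) (kummerCover act j)) ∘ₗ totalLefschetz ℓ =
      totalLefschetz (complexBetti.map (kummerCover act j) 2 ℓ) ∘ₗ
        totalPullback ℂ (AlgPoints.mapContinuous (L := ℂ) (kummerCover act j)) := by
    refine LinearMap.ext fun w ↦ ?_
    simp only [LinearMap.coe_comp, Function.comp_apply]
    exact (totalLefschetz_totalPullback _ ℓ w).symm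
  exact Literature.Algebra.Lie.comp_dual_eq_dual_comp_of_isSl2Triple (isZGrading_degreeOperator (2 * (n + 1)))
    (isZGrading_degreeOperator (2 + 2 * n)) hΛH tP
    (totalPullback ℂ (AlgPoints.mapContinuous (L := ℂ) (kummerCover act j))) hφh hφe

end Main

end Summit.Ventures.HodgeKum4.HilbertKummer

end
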